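import Literature.NumberTheory.EllipticCurves.IwasawaSelmerControlAwayFromPProofs
import Literature.NumberTheory.GaloisRepresentations.AbsGaloisGroupCompact
import HarnessLib

/-!
# The local `ℤ_p`-tower at a finite place `v ∤ p`: it is a `ℤ_p`-extension of `K_v`, and
# `E(K_{∞,η}) ⊗ ℚ_p/ℤ_p = 0` (Greenberg, LNM 1716, §2 Prop. 2.1) in `E(K̄_v)`-coefficients

`Proofs` file (theorems only: **no definition, no named fact, nothing asserted**). Two tool theorems for
the `E(K̄_v)`-valued cocycle arguments over the local tower `K_{∞,η}/K_v` of a `ℤ_p`-extension `K_∞/K`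
of a number field (consumer: `LocalQuotientControlSurjectiveProofs`, the discharge of Greenberg's p. 108
local surjectivity `Greenberg1999.localQuotient_restriction_surjective`):

* `Literature.NumberTheory.EllipticCurves.ZpExtension.exists_local_kerSubgroup_eq_localSubgroup` — the
  LOCAL `ℤ_p`-extension at a place that does not split completely: for a `ℤ_p`-extension `κ : Γ_K ↠ ℤ_p`
  and a `K`-field `E` (a completion `K_v`) whose restriction `Γ_E → Γ_K` does NOT land in `ker κ`, a
  `ℤ_p`-extension `κ_E` of `E` with `ker κ_E = (Γ_E → Γ_K)⁻¹(ker κ) = Gal(K̄_E/K_∞·E)`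
  (`localSubgroup κ.kerSubgroup E`) and a topological generator (rescale `κ ∘ res` by a value of
  maximal norm; Washington §13.1: closed subgroups of `ℤ_p`). Literature-side twin of the Summits tool
  `Summit.BirchSwinnertonDyer.Rank1Residual.Additive.exists_localZpExtension` (same construction; a
  Literature file cannot import `Summits`). This is how Greenberg treats
  `Γ_v = Gal(K_{v,∞}/K_v) ≅ ℤ_p` in LNM 1716 §3 ("`K_η` is the unramified `ℤ_p`-extension of `F_v`",
  p. 87).
* `Literature.NumberTheory.EllipticCurves.Greenberg1999.exists_sub_smul_mem_primaryComponent_fixedPoints_localSubgroup`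
  — KUMMER VANISHING at `v ∤ p` ("`E(K_η) ⊗ ℚ_p/ℤ_p = 0`", Prop. 2.1, p. 72): for ANY `ℤ_p`-extension and
  a finite `v ∤ p`, `M_∞ = E(K̄_v)^{H_∞} = E(K_{∞,η})` is `p`-divisible modulo `M_∞[p^∞]`. Verbatim the
  step (a) of the tree's `WeierstrassCurve.finite_localTowerKerPrimary_zero_of_not_mem`
  (`IwasawaSelmerControlAwayFromPProofs`), recorded as a theorem: every `ℤ_p`-extension is unramified
  at `v ∤ p` (`ZpExtension.inertia_le_kerSubgroup_holds`), so `M_∞ ⊆ E(K_v^nr)`; on the minimal model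
  `m • y ∈ E₁` for some `m = p^a b ≥ 1`, `p ∤ b` (Kodaira–Néron over `K_v^nr` and the reduction map,
  `exists_nsmul_mem_kernel_of_forall_inertia`), `m • y = p^{a+1} • u` with `u ∈ E₁ ∩ M_∞`
  (`exists_pow_nsmul_eq_of_mem_kernel`: `[p]` is invertible on `E₁` of the complete unramified layers),
  and Bézout.

## References

* [GreenbergLNM1716] R. Greenberg, *Iwasawa theory for elliptic curves*, LNM 1716 (1999), §2 Prop. 2.1
  (p. 72); §3 proof of Lemma 3.3 (p. 87).
* [Washington1997] L. C. Washington, *Introduction to Cyclotomic Fields*, §13.1.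
* [SilvermanAEC2009] J. H. Silverman, *AEC*, 2nd ed. (2009), Prop. VII.2.1, VII.3.1, Cor. VII.6.2.

## Design

No definitions, no named facts; `noncomputable section`; `open scoped Classical NNReal`; one universe
`u`; the second theorem reproduces the setting of `finite_localTowerKerPrimary_zero_of_not_mem` VERBATIM
(same binders and `maxHeartbeats`), hence the long lines. Cell `bsd-2adic`, seat `bsd-2adic-ss-1` GEN 14
(crux `SupersingularRankZeroAtTwo`, stmt-BirchSwinnertonDyer-19097, rung K4): tools for removing the
displayed PRINT binder `hP108` of the COUNT♭@2 door; close nothing by themselves; BSD is not proved by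
any of this. Axioms: `propext`, `Classical.choice`, `Quot.sound`.
-/

noncomputable section

open scoped Classical NNReal

open NumberField IsDedekindDomain Field

universe u
/-! ## §0 The local `ℤ_p`-extension at a place that does not split completely -/

namespace Literature.NumberTheory.EllipticCurves.ZpExtension

open Literature.NumberTheory.EllipticCurves Literature.NumberTheory.GaloisRepresentations

variable {K : Type u} [Field K] {p : ℕ} [hp : Fact p.Prime] (κ : ZpExtension K p)
  (E : Type u) [Field E] [Algebra K E]

/-- **The local `ℤ_p`-extension at a non-split place** (Literature twin of the Summits tool
`Summit.BirchSwinnertonDyer.Rank1Residual.Additive.exists_localZpExtension`, same construction). If some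
`δ ∈ Γ_E` restricts outside `ker κ`, there is a `ℤ_p`-extension `κ_E` of `E` whose kernel is
`Gal(K̄_E/K_∞·E) = res⁻¹(ker κ)` (`localSubgroup κ.kerSubgroup E`) together with a topological generator
`g ∈ Γ_E`. Construction: `x₀ = κ(res g)` of MAXIMAL norm over the compact `Γ_E`
(`IsCompact.exists_isMaxOn`); `κ(res σ)/x₀ ∈ ℤ_p` for all `σ`, the rescaled map is a continuous
homomorphism with `g ↦ 1`, and its image is closed and contains `ℤ`, hence is everything
(`PadicInt.denseRange_intCast`). Greenberg, LNM 1716, §3 p. 87 ("`K_η` is the unramified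
`ℤ_p`-extension of `F_v`"); Washington §13.1 (closed subgroups of `ℤ_p`).
[cite: GreenbergLNM1716, §3 p. 87] [cite: Washington1997, §13.1] -/
theorem exists_local_kerSubgroup_eq_localSubgroup
    (hE : ∃ δ : Field.absoluteGaloisGroup E, resGal (K := K) E δ ∉ κ.kerSubgroup) :
    ∃ (κE : ZpExtension E p) (g : Field.absoluteGaloisGroup E),
      κE.kerSubgroup = localSubgroup κ.kerSubgroup E ∧ κE.IsTopGenerator g := by
  -- adapted from Summits/BirchSwinnertonDyer/Rank1Residual/Additive/LocalZpExtension.lean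
  haveI : CompactSpace (Field.absoluteGaloisGroup E) := absoluteGaloisGroup_compactSpace E
  -- the additive coordinate `a σ = κ(res σ) ∈ ℤ_p`
  let a : Field.absoluteGaloisGroup E → ℤ_[p] := fun σ ↦ (κ (resGal (K := K) E σ)).toAdd
  have ha_cont : Continuous a :=
    continuous_toAdd.comp ((map_continuous κ).comp (map_continuous (resGal (K := K) E)))
  have ha_mul : ∀ σ τ, a (σ * τ) = a σ + a τ := fun σ τ ↦ by
    simp only [a, map_mul, toAdd_mul]
  -- an element `g` of maximal norm
  obtain ⟨g, -, hg⟩ := (isCompact_univ (X := Field.absoluteGaloisGroup E)).exists_isMaxOn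
    Set.univ_nonempty ((continuous_norm.comp ha_cont).continuousOn)
  have hmax : ∀ σ, ‖a σ‖ ≤ ‖a g‖ := fun σ ↦ hg (Set.mem_univ σ)
  set x₀ : ℤ_[p] := a g with hx₀def
  have hx₀ : x₀ ≠ 0 := by
    obtain ⟨δ, hδ⟩ := hE
    intro h0
    have hδ0 : a δ ≠ 0 := fun h ↦ hδ (by
      rw [ZpExtension.mem_kerSubgroup]
      exact Multiplicative.toAdd.injective (by rw [toAdd_one]; exact h))
    have := hmax δ
    rw [h0, norm_zero] at this
    exact hδ0 (norm_le_zero_iff.mp this)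
  have hx₀' : (x₀ : ℚ_[p]) ≠ 0 := PadicInt.coe_ne_zero.mpr hx₀
  -- the rescaled coordinate `y σ = a σ / x₀ ∈ ℤ_p`
  have hnorm : ∀ σ, ‖(a σ : ℚ_[p]) / (x₀ : ℚ_[p])‖ ≤ 1 := fun σ ↦ by
    rw [norm_div, PadicInt.padic_norm_e_of_padicInt, PadicInt.padic_norm_e_of_padicInt]
    exact div_le_one_of_le₀ (hmax σ) (norm_nonneg _)
  let y : Field.absoluteGaloisGroup E → ℤ_[p] := fun σ ↦ ⟨(a σ : ℚ_[p]) / (x₀ : ℚ_[p]), hnorm σ⟩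
  have hy_mul : ∀ σ τ, y (σ * τ) = y σ + y τ := fun σ τ ↦ by
    apply Subtype.ext
    change (a (σ * τ) : ℚ_[p]) / (x₀ : ℚ_[p]) = (a σ : ℚ_[p]) / x₀ + (a τ : ℚ_[p]) / x₀
    rw [ha_mul, PadicInt.coe_add, add_div]
  have hy_one : y 1 = 0 := by
    have h := hy_mul 1 1
    rw [mul_one] at h
    linear_combination -h
  have hy_g : y g = 1 := by
    apply Subtype.ext
    change (a g : ℚ_[p]) / (x₀ : ℚ_[p]) = 1
    rw [← hx₀def, div_self hx₀']
  have hy_cont : Continuous y :=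
    ((continuous_subtype_val.comp ha_cont).div_const _).subtype_mk _
  have hy_x₀ : ∀ σ, a σ = y σ * x₀ := fun σ ↦ by
    apply Subtype.ext
    rw [PadicInt.coe_mul]
    change (a σ : ℚ_[p]) = (a σ : ℚ_[p]) / x₀ * x₀
    rw [div_mul_cancel₀ _ hx₀']
  -- the rescaled continuous homomorphism `Γ_E →ₜ* ℤ_p`
  let φ : Field.absoluteGaloisGroup E →ₜ* Multiplicative ℤ_[p] :=
    { toFun := fun σ ↦ Multiplicative.ofAdd (y σ)
      map_one' := by rw [hy_one, ofAdd_zero]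
      map_mul' := fun σ τ ↦ by rw [hy_mul, ofAdd_add]
      continuous_toFun := continuous_ofAdd.comp hy_cont }
  have hφ : ∀ σ, φ σ = Multiplicative.ofAdd (y σ) := fun _ ↦ rfl
  have hφg : φ g = Multiplicative.ofAdd 1 := by rw [hφ, hy_g]
  -- surjectivity: the image is a closed subgroup of `ℤ_p` containing `ℤ`
  have hsurj : Function.Surjective φ := by
    have hclosed : IsClosed (Set.range φ) := (isCompact_range φ.continuous_toFun).isClosed
    have hsub : Set.range (fun n : ℤ ↦ Multiplicative.ofAdd ((n : ℤ) : ℤ_[p])) ⊆ Set.range φ := by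
      rintro _ ⟨n, rfl⟩
      refine ⟨g ^ n, ?_⟩
      rw [map_zpow, hφg, ← ofAdd_zsmul, zsmul_eq_mul, mul_one]
    have hdense : DenseRange (fun n : ℤ ↦ Multiplicative.ofAdd ((n : ℤ) : ℤ_[p])) :=
      (Multiplicative.ofAdd.surjective.denseRange).comp PadicInt.denseRange_intCast continuous_ofAdd
    have huniv : Set.range φ = Set.univ := by
      have hd : Dense (Set.range φ) := hdense.mono hsub
      rw [← hclosed.closure_eq, hd.closure_eq]
    intro x
    have hx : x ∈ Set.range φ := by rw [huniv]; exact Set.mem_univ x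
    exact hx
  refine ⟨⟨φ, hsurj⟩, g, ?_, hφg⟩
  -- the kernel is `res⁻¹(ker κ)`
  ext σ
  rw [ZpExtension.mem_kerSubgroup, mem_localSubgroup_iff, ZpExtension.mem_kerSubgroup]
  change φ σ = 1 ↔ _
  rw [hφ]
  constructor
  · intro h
    have hy0 : y σ = 0 := Multiplicative.ofAdd.injective (by rw [h, ofAdd_zero])
    have ha0 : a σ = 0 := by rw [hy_x₀ σ, hy0, zero_mul]
    exact Multiplicative.toAdd.injective (by rw [toAdd_one]; exact ha0)
  · intro h
    have ha0 : a σ = 0 := by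
      change (κ (resGal (K := K) E σ)).toAdd = 0
      rw [h, toAdd_one]
    have hy0 : y σ = 0 := by
      apply Subtype.ext
      change (a σ : ℚ_[p]) / (x₀ : ℚ_[p]) = 0
      rw [ha0, PadicInt.coe_zero, zero_div]
    rw [hy0, ofAdd_zero]

end Literature.NumberTheory.EllipticCurves.ZpExtension

/-! ## §1 Kummer vanishing at `v ∤ p`: `E(K_{∞,η})` is `p`-divisible modulo torsion -/

namespace Literature.NumberTheory.EllipticCurves.Greenberg1999

open Literature.NumberTheory.EllipticCurves Literature.NumberTheory.GaloisRepresentations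
  Literature.NumberTheory.EllipticCurves.ZpExtension _root_.WeierstrassCurve
  _root_.IsDedekindDomain.HeightOneSpectrum

variable {K : Type u} [Field K] [NumberField K] (W : WeierstrassCurve K) [W.IsElliptic]
  {p : ℕ} [Fact p.Prime] (κ : ZpExtension K p)

set_option maxHeartbeats 1600000 in
/-- **Kummer vanishing at `v ∤ p` in `E(K̄_v)`-coefficients (Greenberg, LNM 1716, §2 Prop. 2.1, p. 72:
"`E(K_η) ⊗ ℚ_p/ℤ_p = 0`" for `η ∤ p`).** For an elliptic curve `E = W/K` over a number field, a prime
`p`, ANY `ℤ_p`-extension `κ` of `K` and a finite place `v ∤ p`, the group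
`M_∞ = E(K̄_v)^{H_∞} = E(K_{∞,η})` (`H_∞ = Gal(K̄_v/K_{∞,η})` the local subgroup of `ker κ`) is
`p`-divisible modulo its `p`-power torsion: every `y ∈ M_∞` is `p • y'` with `y' ∈ M_∞` up to an
element of `M_∞[p^∞]`. This is VERBATIM the step (a) of the tree's
`WeierstrassCurve.finite_localTowerKerPrimary_zero_of_not_mem` (same binders), recorded as a theorem
of its own: every `ℤ_p`-extension is unramified at `v ∤ p` (`ZpExtension.inertia_le_kerSubgroup_holds`),
so `M_∞ ⊆ E(K_v^nr)`; on the minimal model, `m • y ∈ E₁` for some `m = p^a b ≥ 1`, `p ∤ b`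
(Kodaira–Néron over `K_v^nr` and the reduction map, `exists_nsmul_mem_kernel_of_forall_inertia`),
`m • y = p^{a+1} • u` with `u ∈ E₁ ∩ M_∞` (`exists_pow_nsmul_eq_of_mem_kernel`), and Bézout.
[cite: GreenbergLNM1716, §2 Prop. 2.1 (p. 72); §3 Lemma 3.3 (proof, p. 87)]
[cite: SilvermanAEC2009, Prop. VII.2.1, Prop. VII.3.1, Cor. VII.6.2] -/
theorem exists_sub_smul_mem_primaryComponent_fixedPoints_localSubgroup
    (v : HeightOneSpectrum (𝓞 K)) (hpv : ((p : ℕ) : 𝓞 K) ∉ v.asIdeal) :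
    ∀ y : FixedPoints.addSubgroup (localSubgroup κ.kerSubgroup (v.adicCompletion K))
        (localPoints W (v.adicCompletion K)),
      ∃ y' : FixedPoints.addSubgroup (localSubgroup κ.kerSubgroup (v.adicCompletion K))
          (localPoints W (v.adicCompletion K)),
        y - p • y' ∈ AddCommGroup.primaryComponent
          (FixedPoints.addSubgroup (localSubgroup κ.kerSubgroup (v.adicCompletion K))
            (localPoints W (v.adicCompletion K))) p := by
  -- notation
  let G : Type u := Field.absoluteGaloisGroup (v.adicCompletion K)
  let Pt : Type u := localPoints W (v.adicCompletion K)
  let Hi : Subgroup G := localSubgroup κ.kerSubgroup (v.adicCompletion K)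
  -- the spectral valuation, the prime `𝔐`, `p ∈ 𝓞_vˣ`, inertia
  obtain ⟨w, hw⟩ := v.exists_spectralValuation
  obtain ⟨𝔐, h𝔐⟩ := v.localPrimesAbove_nonempty
  have hp : IsUnit ((p : ℕ) : (v.adicCompletionIntegers K)) := by
    have h := isUnit_algebraMap_adicCompletionIntegers K v hpv
    rwa [map_natCast] at h
  have hI : ∀ σ ∈ 𝔐.inertia G, σ ∈ Hi := fun σ hσ ↦
    (mem_localSubgroup_iff _ _ σ).mpr
      (ZpExtension.inertia_le_kerSubgroup_holds K p κ hpv (primeBelow_mem_primesAbove h𝔐)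
        (v.resGalOfEmb_mem_inertia_primeBelow (closureEmb (K := K) (v.adicCompletion K)) 𝔐 hσ))
  -- the equivariant transport `E(K̄_v) ≃ V(K̄_v)` to the minimal model (as for Milne, ADT I.3.8)
  obtain ⟨C, hC⟩ := W.exists_variableChange_eq_localMinimalIntegralModel v
  haveI := WeierstrassCurve.isIntegral_spectralValuation_baseChange hw (W.localMinimalIntegralModel v)
  have hC' := congrArg (fun X : WeierstrassCurve (v.adicCompletion K) ↦ X.baseChange (AlgebraicClosure (v.adicCompletion K))) hC
  let Φ : Pt ≃+ (((W.localMinimalIntegralModel v).map (algebraMap (v.adicCompletionIntegers K) (v.adicCompletion K))).baseChange (AlgebraicClosure (v.adicCompletion K))).toAffine.Point :=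
    ((WeierstrassCurve.Affine.Point.congrEquiv
        (WeierstrassCurve.baseChange_baseChange_adicCompletion W v).symm).trans
      (WeierstrassCurve.VariableChange.pointEquivBaseChange (W.baseChange (v.adicCompletion K)) C
        (AlgebraicClosure (v.adicCompletion K)))).trans
      (WeierstrassCurve.Affine.Point.congrEquiv hC')
  have hΦ : ∀ (σ : G) (Q : Pt), Φ (σ • Q) = Affine.Point.map ((absoluteGaloisGroup.toAlgEquiv (v.adicCompletion K) σ : AlgebraicClosure (v.adicCompletion K) ≃ₐ[v.adicCompletion K] AlgebraicClosure (v.adicCompletion K)) : AlgebraicClosure (v.adicCompletion K) →ₐ[v.adicCompletion K] AlgebraicClosure (v.adicCompletion K)) (Φ Q) := by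
    intro σ Q
    change WeierstrassCurve.Affine.Point.congrEquiv hC'
        (WeierstrassCurve.VariableChange.pointEquivBaseChange (W.baseChange (v.adicCompletion K)) C (AlgebraicClosure (v.adicCompletion K))
        (WeierstrassCurve.Affine.Point.congrEquiv (WeierstrassCurve.baseChange_baseChange_adicCompletion W v).symm (σ • Q))) =
      WeierstrassCurve.Affine.Point.map _ (WeierstrassCurve.Affine.Point.congrEquiv hC'
        (WeierstrassCurve.VariableChange.pointEquivBaseChange (W.baseChange (v.adicCompletion K)) C (AlgebraicClosure (v.adicCompletion K))
          (WeierstrassCurve.Affine.Point.congrEquiv (WeierstrassCurve.baseChange_baseChange_adicCompletion W v).symm Q)))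
    rw [WeierstrassCurve.congrEquiv_smul, WeierstrassCurve.VariableChange.pointEquivBaseChange_map_algEquiv]
    exact WeierstrassCurve.Affine.Point.congrEquiv_baseChange_map hC _ _
  -- `M_∞ = E(K̄_v)^{H_{v,∞}}`, `B = M_∞[p^∞]`
  set Mi : AddSubgroup Pt := FixedPoints.addSubgroup Hi Pt with hMi
  set B : AddSubgroup Mi := AddCommGroup.primaryComponent Mi p with hB
  have hMiI : ∀ (m : Mi) (τ : G), τ ∈ 𝔐.inertia G → Affine.Point.map ((absoluteGaloisGroup.toAlgEquiv (v.adicCompletion K) τ : AlgebraicClosure (v.adicCompletion K) ≃ₐ[v.adicCompletion K] AlgebraicClosure (v.adicCompletion K)) : AlgebraicClosure (v.adicCompletion K) →ₐ[v.adicCompletion K] AlgebraicClosure (v.adicCompletion K)) (Φ m) = Φ m := by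
    intro m τ hτ
    rw [← hΦ]
    exact congrArg Φ (m.2 ⟨τ, hI τ hτ⟩)
  intro y
  obtain ⟨m, hm, hmK⟩ :=
    W.exists_nsmul_mem_kernel_of_forall_inertia hw h𝔐 (P := Φ y) (fun τ hτ ↦ hMiI y τ hτ)
  obtain ⟨a, b, hb, hmab⟩ :=
    Nat.exists_eq_pow_mul_and_not_dvd hm.ne' p (Fact.out : p.Prime).ne_one
  -- `m • Φ y = p^(a+1) • u` with `u ∈ E₁` fixed by `H_{v,∞}`
  have hmI : ∀ τ ∈ 𝔐.inertia G, Affine.Point.map ((absoluteGaloisGroup.toAlgEquiv (v.adicCompletion K) τ : AlgebraicClosure (v.adicCompletion K) ≃ₐ[v.adicCompletion K] AlgebraicClosure (v.adicCompletion K)) : AlgebraicClosure (v.adicCompletion K) →ₐ[v.adicCompletion K] AlgebraicClosure (v.adicCompletion K)) (m • Φ y) = m • Φ y :=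
    fun τ hτ ↦ by rw [map_nsmul, hMiI y τ hτ]
  obtain ⟨u, -, hufix, hu⟩ := W.exists_pow_nsmul_eq_of_mem_kernel hw h𝔐 hp (a + 1) hmK hmI
  -- `u` comes from `M_∞`
  have hu' : Φ.symm u ∈ Mi := by
    rintro ⟨h, hh⟩
    show h • Φ.symm u = Φ.symm u
    apply Φ.injective
    rw [hΦ, AddEquiv.apply_symm_apply]
    refine hufix h ?_
    rw [map_nsmul, ← hΦ]
    exact congrArg (fun z ↦ m • Φ z) (y.2 ⟨h, hh⟩)
  set u' : Mi := ⟨Φ.symm u, hu'⟩ with hu'def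
  -- `T₀ = b • y - p • u'` is `p^a`-torsion
  have hT₀ : b • y - p • u' ∈ B := by
    rw [hB, PrimaryCoinvariants.mem_primaryComponent_iff_exists_nsmul]
    refine ⟨a, ?_⟩
    apply Subtype.ext
    apply Φ.injective
    simp only [smul_sub, AddSubgroupClass.coe_nsmul, AddSubgroupClass.coe_sub, map_sub, map_nsmul,
      ZeroMemClass.coe_zero, map_zero, hu'def, AddEquiv.apply_symm_apply]
    rw [← mul_smul, ← mul_smul, ← pow_succ, hu, ← hmab, sub_self]
  -- Bézout
  have hcop : IsCoprime (b : ℤ) (p : ℤ) :=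
    Nat.isCoprime_iff_coprime.mpr ((Nat.Prime.coprime_iff_not_dvd Fact.out).mpr hb).symm
  obtain ⟨α, β, hαβ⟩ := hcop
  refine ⟨α • u' + β • y, ?_⟩
  have e : y - p • (α • u' + β • y) = α • (b • y - p • u') := by
    have h2 : (1 - (α * b + β * p)) • y = 0 := by rw [hαβ, sub_self, zero_smul]
    have h3 : y - p • (α • u' + β • y) - α • (b • y - p • u') = (1 - (α * b + β * p)) • y := by
      module
    rw [← sub_eq_zero, h3, h2]
  rw [e]
  exact B.zsmul_mem hT₀ α

end Literature.NumberTheory.EllipticCurves.Greenberg1999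

end
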